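import Summits.ResolutionOfSingularities.ResolutionOfSingularities.Theorems.RadicialJungCleanModelsLogContentIdealGenerators
import Mathlib.RingTheory.Kaehler.Basic
import Mathlib.Algebra.Module.Projective
import HarnessLib

/-!
# Route `RadicialJung`, crux `CleanModels` (stmt-15917): the log-Jacobian content ideal controls
# EVERY module-valued logarithmic derivation (Giraud 1983, 1.1 (2) and 2.5, Ω-free)

Support file (OURS) for PROGRAMME-clean-dim2 (brick K3c-iv of
`HOME/L/res-L0-w81-pv-2/g4/PROGRAMME-giraud-arbitrary-k.md`, W8.1), line `via-clean-models` of the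
crux `DescentPerfectToAll` (stmt-0549). Nothing here is a statement of Hironaka's manuscript.

Giraud (Bull. SMF 111 (1983), 1.1 (2)) defines the log-Jacobian ideal `J(X, f, E)` of a function
`f` along a normal crossings divisor `E = div(x₁ ⋯ x_r)` as the content ideal of `df` in the
locally free sheaf `Ω¹_X(log E)`; the first sentence of his 2.5 ("on a
`J(X′, ω′, E(ω′)) = J(X, ω, E(ω)) 𝒪_{X′}`") and all of his chart computations rest on the fact that
this content ideal controls the value `⟨φ, df⟩` of ANY `𝒪_{X′}`-valued functional `φ`. Over a
non-`F`-finite field `Ω¹_X` is not of finite rank; the tree's Ω-free rendering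
(`RadicialJungCleanModelsLogContentIdealGenerators.lean`) is
`J(O, f; log x) := ⟨D f : D ∈ Der(O), x_j ∣ D x_j⟩`. This file proves the controlling property in
that rendering, for a commutative ring `O` whose module of absolute Kähler differentials
`Ω[O⁄ℤ]` is PROJECTIVE (every local ring formally smooth over `𝔽_p`, in particular every regular
local ring essentially of finite type over ANY field of characteristic `p`:
`projective_kaehler_int_of_zmod`) and boundary equations `x_j` admitting dual derivations
`∂_i x_j = δ_ij` (`exists_dual_derivations_int`):

* `derivation_apply_mem_span_logDerivation_smul` — **master lemma**: for ANY `O`-module `M`, a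
  submodule `M′ ≤ M` and a derivation `d : O → M` with `d(O) ⊆ M′` and `d x_j ∈ x_j • M′`
  (logarithmic along `x` with values in `M′`), `d f ∈ J(O, f; log x) • M′`. Proof: split
  `df = Σ_j ∂_j f · dx_j + ω₀`; expand `ω₀` along a projective coordinate system `s` of `Ω[O⁄ℤ]`;
  each coordinate `s(ω₀)_i` is the value on `f` of the derivation
  `ψ_i ∘ d − Σ_j ψ_i(dx_j) ∂_j`, which kills every `x_j`.
* `derivation_apply_mem_map_span_logDerivation` — algebra-valued form: for an `O`-algebra `T` and
  a derivation `d : O → T` with `x_j ∣ d x_j` in `T`, `d f ∈ J(O, f; log x)·T`.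
* `span_logDerivation_restrict_le_map` — hence for every `O`-algebra `T` the ideal generated by the
  values `D f`, `D ∈ Der(T)` logarithmic along the images of the `x_j`, is contained in
  `J(O, f; log x)·T` (the inclusion `J(X′, f, E′) ⊆ J(X, f, E)𝒪_{X′}` of Giraud 1.6 (4) / 2.5 at
  every point of any `X′ → X` along which the `x_j` stay boundary equations).

## References
* J. Giraud, Forme normale d'une fonction sur une surface de caractéristique positive, Bull. Soc.
  Math. France 111 (1983) 109–124: 1.1 (2), Rem. 1.6 (4), 2.5. [Giraud1983]
* H. Matsumura, Commutative Ring Theory (1986), Thm. 30.6 (ii) (dual derivations). [Matsumura1987]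
-/

noncomputable section

set_option linter.dupNamespace false -- mandated namespace of this single-conjunct summit

open KaehlerDifferential Module
open Literature.AlgebraicGeometry.Resolution

namespace Summit.ResolutionOfSingularities.ResolutionOfSingularities.Theorems.RadicialJung.CleanModels

universe u v

section Master

variable {O : Type u} [CommRing O] {r : ℕ} {x : Fin r → O} {δ : Fin r → Derivation ℤ O O}

/-- The logarithmic derivation `x_j • ∂_j` witnesses `x_j · ∂_j f ∈ J(O, f; log x)`.
[cite: Giraud1983, 1.1 (2)–(3)] -/
theorem mul_dual_apply_mem_span_logDerivation
    (hδ : ∀ i j, δ i (x j) = if i = j then 1 else 0) (f : O) (j : Fin r) :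
    x j * δ j f ∈
      Ideal.span {v : O | ∃ D : Derivation ℤ O O, (∀ j, x j ∣ D (x j)) ∧ D f = v} := by
  refine Ideal.subset_span ⟨x j • δ j, fun i => ?_, by simp [smul_eq_mul]⟩
  rw [Derivation.smul_apply, smul_eq_mul, hδ]
  by_cases h : j = i
  · subst h; simp
  · simp [h]

/-- The image of the lift `φ : Ω[O⁄ℤ] → M` of a derivation `d : O → M` with `d(O) ⊆ M′` lies in
`M′` (the Kähler module is spanned by the `da`). [folklore] -/
theorem liftKaehlerDifferential_apply_mem {M : Type v} [AddCommGroup M] [Module O M]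
    (M' : Submodule O M) (d : Derivation ℤ O M) (hd : ∀ a, d a ∈ M') (ω : Ω[O⁄ℤ]) :
    d.liftKaehlerDifferential ω ∈ M' := by
  have hω : ω ∈ Submodule.span O (Set.range (D ℤ O)) := by
    rw [KaehlerDifferential.span_range_derivation]; trivial
  induction hω using Submodule.span_induction with
  | mem _ h =>
    obtain ⟨a, rfl⟩ := h
    rw [Derivation.liftKaehlerDifferential_comp_D]; exact hd a
  | zero => rw [map_zero]; exact M'.zero_mem
  | add _ _ _ _ h₁ h₂ => rw [map_add]; exact M'.add_mem h₁ h₂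
  | smul c _ _ h => rw [map_smul]; exact M'.smul_mem c h

/-- **Master lemma: the log-Jacobian content ideal controls every module-valued logarithmic
derivation.** Let `Ω[O⁄ℤ]` be projective, `x : Fin r → O` with dual derivations
`∂_i x_j = δ_ij`, `M′ ≤ M` `O`-modules and `d : O → M` a derivation with `d(O) ⊆ M′` and
`d x_j ∈ x_j • M′` for all `j`. Then for every `f`,
`d f ∈ J(O, f; log x) • M′`, `J(O, f; log x) = ⟨D f : D ∈ Der(O), x_j ∣ D x_j⟩`.
(Giraud: `⟨φ, df⟩ ∈ J(X, f, E)·𝒪′` for every `𝒪′`-valued functional `φ` on `Ω¹_X(log E)`.)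
[cite: Giraud1983, 1.1 (2) and 2.5] [cite: Matsumura1987, Thm. 30.6 (ii)] -/
theorem derivation_apply_mem_span_logDerivation_smul [Module.Projective O Ω[O⁄ℤ]]
    (hδ : ∀ i j, δ i (x j) = if i = j then 1 else 0)
    {M : Type v} [AddCommGroup M] [Module O M] (M' : Submodule O M)
    (d : Derivation ℤ O M) (hd : ∀ a, d a ∈ M') (hlog : ∀ j, ∃ m ∈ M', d (x j) = x j • m)
    (f : O) :
    d f ∈ Ideal.span {v : O | ∃ D : Derivation ℤ O O, (∀ j, x j ∣ D (x j)) ∧ D f = v} • M' := by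
  classical
  set J : Ideal O :=
    Ideal.span {v : O | ∃ D : Derivation ℤ O O, (∀ j, x j ∣ D (x j)) ∧ D f = v} with hJ
  -- a projective coordinate system of `Ω[O⁄ℤ]`
  obtain ⟨s, hs⟩ := Module.projective_def'.mp ‹Module.Projective O Ω[O⁄ℤ]›
  let φ : Ω[O⁄ℤ] →ₗ[O] M := d.liftKaehlerDifferential
  have hφ : ∀ ω, φ ω ∈ M' := liftKaehlerDifferential_apply_mem M' d hd
  -- split off the `dx_j`-part of `df`
  let ω₀ : Ω[O⁄ℤ] := D ℤ O f - ∑ j, δ j f • D ℤ O (x j)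
  have hdf : d f = φ ω₀ + ∑ j, δ j f • d (x j) := by
    have h1 : φ (D ℤ O f) = d f := Derivation.liftKaehlerDifferential_comp_D d f
    have h2 : ∀ j, φ (D ℤ O (x j)) = d (x j) := fun j =>
      Derivation.liftKaehlerDifferential_comp_D d (x j)
    simp only [ω₀, map_sub, map_sum, map_smul, h1, h2, sub_add_cancel]
  -- every coordinate of `ω₀` lies in `J`
  have hcoef : ∀ i, s ω₀ i ∈ J := by
    intro i
    let ψ : Ω[O⁄ℤ] →ₗ[O] O := (Finsupp.lapply i) ∘ₗ s
    let Dψ : Derivation ℤ O O := ψ.compDer (D ℤ O)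
    have hDψ : ∀ a, Dψ a = ψ (D ℤ O a) := fun a => rfl
    let D' : Derivation ℤ O O := Dψ - ∑ j, Dψ (x j) • δ j
    have hD'x : ∀ k, D' (x k) = 0 := derivation_sub_sum_smul_apply_eq_zero x δ hδ Dψ
    have hD'f : D' f = s ω₀ i := by
      have : D' f = Dψ f - ∑ j, Dψ (x j) * δ j f := by
        change (Dψ - ∑ j, Dψ (x j) • δ j) f = _
        rw [Derivation.sub_apply, derivation_sum_apply]
        simp only [Derivation.smul_apply, smul_eq_mul]
      rw [this, hDψ]
      simp only [hDψ]
      have hψ : ψ ω₀ = ψ (D ℤ O f) - ∑ j, δ j f * ψ (D ℤ O (x j)) := by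
        simp only [ω₀, map_sub, map_sum, map_smul, smul_eq_mul]
      rw [show s ω₀ i = ψ ω₀ from rfl, hψ]
      congr 1
      exact Finset.sum_congr rfl fun j _ => mul_comm _ _
    exact Ideal.subset_span ⟨D', fun k => ⟨0, by rw [hD'x, mul_zero]⟩, hD'f⟩
  -- `φ ω₀ ∈ J • M′`
  have hω₀ : φ ω₀ ∈ J • M' := by
    have hexp : ω₀ = ∑ i ∈ (s ω₀).support, s ω₀ i • i := by
      have h := LinearMap.congr_fun hs ω₀
      rw [LinearMap.comp_apply, LinearMap.id_apply] at h
      conv_lhs => rw [← h]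
      rw [Finsupp.linearCombination_apply, Finsupp.sum]
      rfl
    rw [hexp, map_sum]
    refine Submodule.sum_mem _ fun i _ => ?_
    rw [map_smul]
    exact Submodule.smul_mem_smul (hcoef i) (hφ i)
  rw [hdf]
  refine Submodule.add_mem _ hω₀ (Submodule.sum_mem _ fun j _ => ?_)
  obtain ⟨m, hm, hj⟩ := hlog j
  rw [hj, ← mul_smul, mul_comm]
  exact Submodule.smul_mem_smul (mul_dual_apply_mem_span_logDerivation hδ f j) hm

/-- **Algebra-valued form.** For an `O`-algebra `T` and a derivation `d : O → T` logarithmic along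
`x` IN `T` (`x_j ∣ d x_j` in `T`): `d f ∈ J(O, f; log x)·T`. [cite: Giraud1983, Rem. 1.6 (4), 2.5] -/
theorem derivation_apply_mem_map_span_logDerivation [Module.Projective O Ω[O⁄ℤ]]
    (hδ : ∀ i j, δ i (x j) = if i = j then 1 else 0)
    {T : Type v} [CommRing T] [Algebra O T] (d : Derivation ℤ O T)
    (hlog : ∀ j, algebraMap O T (x j) ∣ d (x j)) (f : O) :
    d f ∈ (Ideal.span {v : O | ∃ D : Derivation ℤ O O, (∀ j, x j ∣ D (x j)) ∧ D f = v}).map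
      (algebraMap O T) := by
  have h := derivation_apply_mem_span_logDerivation_smul hδ (⊤ : Submodule O T) d
    (fun _ => trivial) (fun j => ?_) f
  · rw [Ideal.smul_top_eq_map] at h
    exact h
  · obtain ⟨t, ht⟩ := hlog j
    exact ⟨t, trivial, by rw [ht, Algebra.smul_def]⟩

/-- **`J(T, f; log x) ⊆ J(O, f; log x)·T` for every `O`-algebra `T`**: the ideal of `T` generated
by the values `D f` of the derivations of `T` logarithmic along (the images of) the `x_j` is
contained in the extension of `J(O, f; log x)` — Giraud's `J(X′, f∘e, E′) ⊆ J(X, f, E)𝒪_{X′}` at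
every point of any `X′ → X` along which the `x_j` remain boundary equations; with 1.6 (4) this is
the equality of the first sentence of his 2.5. [cite: Giraud1983, Rem. 1.6 (4), 2.5] -/
theorem span_logDerivation_restrict_le_map [Module.Projective O Ω[O⁄ℤ]]
    (hδ : ∀ i j, δ i (x j) = if i = j then 1 else 0)
    {T : Type v} [CommRing T] [Algebra O T] (f : O) :
    Ideal.span {w : T | ∃ D : Derivation ℤ T T,
        (∀ j, algebraMap O T (x j) ∣ D (algebraMap O T (x j))) ∧ D (algebraMap O T f) = w} ≤
      (Ideal.span {v : O | ∃ D : Derivation ℤ O O, (∀ j, x j ∣ D (x j)) ∧ D f = v}).map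
        (algebraMap O T) := by
  rw [Ideal.span_le]
  rintro _ ⟨D', hlog, rfl⟩
  have h := derivation_apply_mem_map_span_logDerivation hδ (D'.compAlgebraMap O)
    (fun j => hlog j) f
  exact h

end Master

/-! ## The non-logarithmic core: the `dx`-free part of ANY module-valued derivation -/

section Core

variable {O : Type u} [CommRing O] {r : ℕ} {x : Fin r → O} {δ : Fin r → Derivation ℤ O O}

/-- **Core lemma (no logarithmic hypothesis).** Let `Ω[O⁄ℤ]` be projective, `x : Fin r → O` with
dual derivations `∂_i x_j = δ_ij`, `M′ ≤ M` `O`-modules and `d : O → M` ANY derivation with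
`d(O) ⊆ M′`. Then for every `f`,
`d f − Σ_j ∂_j f • d x_j ∈ N(O, f; x) • M′`, where `N(O, f; x) = ⟨D f : D ∈ Der(O), D x_j = 0 ∀ j⟩`
is the ideal of values on `f` of the derivations killing every `x_j` (Giraud: the coordinates of
`df` off the `dx_j` control every functional vanishing on the `dx_j`). Used at the points of a
blow-up where the `x_j` are no longer boundary equations (e.g. `d y ∈ x𝒪′` on the chart
`𝒪′ ∋ y/x`), and to prove `E(f∘e) ⊇ e⁻¹ E(f)`. [cite: Giraud1983, 1.1 (2), 2.5]
[cite: Matsumura1987, Thm. 30.6 (ii)] -/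
theorem derivation_apply_sub_sum_mem_span_nullDerivation_smul [Module.Projective O Ω[O⁄ℤ]]
    (hδ : ∀ i j, δ i (x j) = if i = j then 1 else 0)
    {M : Type v} [AddCommGroup M] [Module O M] (M' : Submodule O M)
    (d : Derivation ℤ O M) (hd : ∀ a, d a ∈ M') (f : O) :
    d f - ∑ j, δ j f • d (x j) ∈
      Ideal.span {v : O | ∃ D : Derivation ℤ O O, (∀ j, D (x j) = 0) ∧ D f = v} • M' := by
  classical
  set N : Ideal O :=
    Ideal.span {v : O | ∃ D : Derivation ℤ O O, (∀ j, D (x j) = 0) ∧ D f = v} with hN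
  obtain ⟨s, hs⟩ := Module.projective_def'.mp ‹Module.Projective O Ω[O⁄ℤ]›
  let φ : Ω[O⁄ℤ] →ₗ[O] M := d.liftKaehlerDifferential
  have hφ : ∀ ω, φ ω ∈ M' := liftKaehlerDifferential_apply_mem M' d hd
  let ω₀ : Ω[O⁄ℤ] := D ℤ O f - ∑ j, δ j f • D ℤ O (x j)
  have hdf : d f - ∑ j, δ j f • d (x j) = φ ω₀ := by
    have h1 : φ (D ℤ O f) = d f := Derivation.liftKaehlerDifferential_comp_D d f
    have h2 : ∀ j, φ (D ℤ O (x j)) = d (x j) := fun j =>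
      Derivation.liftKaehlerDifferential_comp_D d (x j)
    simp only [ω₀, map_sub, map_sum, map_smul, h1, h2]
  have hcoef : ∀ i, s ω₀ i ∈ N := by
    intro i
    let ψ : Ω[O⁄ℤ] →ₗ[O] O := (Finsupp.lapply i) ∘ₗ s
    let Dψ : Derivation ℤ O O := ψ.compDer (D ℤ O)
    have hDψ : ∀ a, Dψ a = ψ (D ℤ O a) := fun a => rfl
    let D' : Derivation ℤ O O := Dψ - ∑ j, Dψ (x j) • δ j
    have hD'x : ∀ k, D' (x k) = 0 := derivation_sub_sum_smul_apply_eq_zero x δ hδ Dψ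
    have hD'f : D' f = s ω₀ i := by
      have : D' f = Dψ f - ∑ j, Dψ (x j) * δ j f := by
        change (Dψ - ∑ j, Dψ (x j) • δ j) f = _
        rw [Derivation.sub_apply, derivation_sum_apply]
        simp only [Derivation.smul_apply, smul_eq_mul]
      rw [this, hDψ]
      simp only [hDψ]
      have hψ : ψ ω₀ = ψ (D ℤ O f) - ∑ j, δ j f * ψ (D ℤ O (x j)) := by
        simp only [ω₀, map_sub, map_sum, map_smul, smul_eq_mul]
      rw [show s ω₀ i = ψ ω₀ from rfl, hψ]
      congr 1
      exact Finset.sum_congr rfl fun j _ => mul_comm _ _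
    exact Ideal.subset_span ⟨D', hD'x, hD'f⟩
  have hexp : ω₀ = ∑ i ∈ (s ω₀).support, s ω₀ i • i := by
    have h := LinearMap.congr_fun hs ω₀
    rw [LinearMap.comp_apply, LinearMap.id_apply] at h
    conv_lhs => rw [← h]
    rw [Finsupp.linearCombination_apply, Finsupp.sum]
    rfl
  rw [hdf, hexp, map_sum]
  refine Submodule.sum_mem _ fun i _ => ?_
  rw [map_smul]
  exact Submodule.smul_mem_smul (hcoef i) (hφ i)

/-- **Algebra-valued core lemma.** For an `O`-algebra `T`, a derivation `d : O → T` and `f ∈ O`: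
`d f − Σ_j ∂_j f · d x_j ∈ N(O, f; x)·T`. [cite: Giraud1983, 1.1 (2), 2.5] -/
theorem derivation_apply_sub_sum_mem_map_span_nullDerivation [Module.Projective O Ω[O⁄ℤ]]
    (hδ : ∀ i j, δ i (x j) = if i = j then 1 else 0)
    {T : Type v} [CommRing T] [Algebra O T] (d : Derivation ℤ O T) (f : O) :
    d f - ∑ j, δ j f • d (x j) ∈
      (Ideal.span {v : O | ∃ D : Derivation ℤ O O, (∀ j, D (x j) = 0) ∧ D f = v}).map
        (algebraMap O T) := by
  have h := derivation_apply_sub_sum_mem_span_nullDerivation_smul hδ (⊤ : Submodule O T) d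
    (fun _ => trivial) f
  rw [Ideal.smul_top_eq_map] at h
  exact h

/-- **Values in an ideal.** If `d : O → T` (an `O`-algebra) has `∂_j f · d x_j ∈ I` for every `j`
and `N(O, f; x)·T ⊆ I` for an ideal `I` of `T`, then `d f ∈ I`. The form used on blow-up charts:
e.g. `d x, d y ∈ x T` gives `d f ∈ (x ∂_x f, x ∂_y f) T + N(O,f;x,y) T`, and `∂_j f ∈ 𝔪`,
`N ⊆ 𝔪`, `𝔪 T ⊆ 𝔪′` gives `d f ∈ 𝔪′` (`E(f∘e) ⊇ e⁻¹E(f)`). [cite: Giraud1983, 1.1 (2), 2.5] -/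
theorem derivation_apply_mem_of_forall_mem [Module.Projective O Ω[O⁄ℤ]]
    (hδ : ∀ i j, δ i (x j) = if i = j then 1 else 0)
    {T : Type v} [CommRing T] [Algebra O T] (d : Derivation ℤ O T) (f : O) (I : Ideal T)
    (hI : ∀ j, δ j f • d (x j) ∈ I)
    (hN : (Ideal.span {v : O | ∃ D : Derivation ℤ O O, (∀ j, D (x j) = 0) ∧ D f = v}).map
        (algebraMap O T) ≤ I) :
    d f ∈ I := by
  have h := hN (derivation_apply_sub_sum_mem_map_span_nullDerivation hδ d f)
  have : d f = (d f - ∑ j, δ j f • d (x j)) + ∑ j, δ j f • d (x j) := by abel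
  rw [this]
  exact I.add_mem h (I.sum_mem fun j _ => hI j)

end Core

end Summit.ResolutionOfSingularities.ResolutionOfSingularities.Theorems.RadicialJung.CleanModels

end
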